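import Summits.NavierStokesRegularity.NavierStokesRegularity.Theorems.ScaledTopAlignmentW3Rung
import HarnessLib

/-!
# Route `ScaledTopAlignment`: the door W3 = `AprioriScaledTopAlignment` (stmt-NavierStokesRegularity-19901)
# holds at every solution that extends past `T` — all its content sits at a first blow-up time

Route.md «KILL CRITERIA»: "A refutation of AprioriScaledTopAlignment needs ONE classical Leray–Hopf
solution with unbounded vorticity on [0,T) … i.e. a blow-up". This file records that placement as
kernel theorems (no new definitions; W3's conclusion written out):

* `scaledTopAlignmentAt_of_hasSmoothExtensionPast` — if the classical solution on `ℝ³ × [0, T)`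
  (Leray–Hopf from its rapidly decaying datum) extends classically past `T`, W3's conclusion holds at it
  for all `λ > 0`, `R > 0`, `ε > 0`: the tree's regular case of W1 (`stub_regularAligned`: a uniform
  Lipschitz bound of the vorticity below a regular time gives a `t`-uniform sine modulus on every level
  set) fed into the lever `scaledTopSine_le_of_sineCoherent`;
* `scaledTopAlignmentAt_of_lt` — unconditionally, W3's conclusion holds on every compact sub-interval
  `[0, T'')`, `T'' < T`, of the lifespan;
* **`aprioriScaledTopAlignment_iff_singular`** — BY NAME: W3 is equivalent to W3 restricted to solutions
  that do NOT extend past `T` (`¬ HasSmoothExtensionPast ν 0 u T`); with the residual hard core NoTypeII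
  these are Type-I blow-ups, the regime of GAP″ (`scaledTopAlignment_typeIZoomNonAlignedLimit_proof`) and
  of Giga–Miura's (CA′) (`gigaMiura2011_scaledAlignment_typeI_holds`).

WHAT THIS IS NOT: not NS regularity and not a proof of W3; it localises W3's open content to the first
singular time.
-/

noncomputable section

-- the summit and its single sub-problem share the name (CONVENTIONS §1), as in every Theorems file
set_option linter.dupNamespace false

open Set Function Filter Topology
open scoped RealInnerProductSpace

namespace Summit.NavierStokesRegularity.NavierStokesRegularity.Theorems

open Literature.Analysis Literature.Analysis.FluidPDE

/-- **W3 at a solution that extends past `T`.** For `ν > 0`, `T > 0`, a classical solution `(u, p)` on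
`ℝ³ × [0, T)`, Leray–Hopf from its rapidly decaying datum `u 0`, which extends classically past `T`,
and all `λ > 0`, `R > 0`, `ε > 0`, there is `M > 0` such that for `t ∈ [0, T)`, `|ω(t,x)| ≥ M`,
`λ|ω(t,x)| ≤ |ω(t,y)|`, `|x − y| ≤ R√(ν/|ω(t,x)|)` the direction sine of `ω(t,x), ω(t,y)` is `≤ ε`
(`ω = curl u`): the regular case of W1 (`stub_regularAligned`, level `d = 1`) and the lever
`scaledTopSine_le_of_sineCoherent`. [folklore] -/
theorem scaledTopAlignmentAt_of_hasSmoothExtensionPast {ν T : ℝ} (hν : 0 < ν) (hT : 0 < T)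
    {u : ℝ → EuclideanSpace ℝ (Fin 3) → EuclideanSpace ℝ (Fin 3)}
    {p : ℝ → EuclideanSpace ℝ (Fin 3) → ℝ}
    (hcl : IsClassicalNSSolutionOn (Ico 0 T) ν 0 u p) (hLH : IsLerayHopfOn T ν 0 (u 0) u)
    (hdec : HasRapidSpatialDecay (u 0)) (hext : HasSmoothExtensionPast ν 0 u T)
    {lam R ε : ℝ} (hlam : 0 < lam) (hR : 0 < R) (hε : 0 < ε) :
    ∃ M : ℝ, 0 < M ∧ ∀ t ∈ Ico 0 T, ∀ x y : EuclideanSpace ℝ (Fin 3),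
      M ≤ ‖curl (u t) x‖ → lam * ‖curl (u t) x‖ ≤ ‖curl (u t) y‖ →
      ‖x - y‖ ≤ R * Real.sqrt (ν / ‖curl (u t) x‖) →
        Real.sqrt (1 - (inner ℝ (‖curl (u t) x‖⁻¹ • curl (u t) x)
          (‖curl (u t) y‖⁻¹ • curl (u t) y)) ^ 2) ≤ ε :=
  scaledTopSine_le_of_sineCoherent (ω := fun t => curl (u t)) hν one_pos
    (stub_regularAligned ν T hν hT u p hcl hLH hdec hext 1 one_pos) hlam hR hε

/-- **W3 holds on every compact sub-interval of the lifespan, unconditionally.** For a classical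
solution on `ℝ³ × [0, T)`, Leray–Hopf from its rapidly decaying datum, and `0 < T'' < T`, W3's conclusion
holds with `t` restricted to `[0, T'')` (the solution is its own extension past `T''`;
`aprioriContinuousAlignment_of_lt` + the lever). Hence all content of the door W3 is the uniformity of
the threshold `M` as `T'' ↑ T` at a first blow-up time. [folklore] -/
theorem scaledTopAlignmentAt_of_lt {ν T : ℝ} (hν : 0 < ν) (hT : 0 < T)
    {u : ℝ → EuclideanSpace ℝ (Fin 3) → EuclideanSpace ℝ (Fin 3)}
    {p : ℝ → EuclideanSpace ℝ (Fin 3) → ℝ}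
    (hcl : IsClassicalNSSolutionOn (Ico 0 T) ν 0 u p) (hLH : IsLerayHopfOn T ν 0 (u 0) u)
    (hdec : HasRapidSpatialDecay (u 0)) {T'' : ℝ} (hT''0 : 0 < T'') (hT'' : T'' < T)
    {lam R ε : ℝ} (hlam : 0 < lam) (hR : 0 < R) (hε : 0 < ε) :
    ∃ M : ℝ, 0 < M ∧ ∀ t ∈ Ico 0 T'', ∀ x y : EuclideanSpace ℝ (Fin 3),
      M ≤ ‖curl (u t) x‖ → lam * ‖curl (u t) x‖ ≤ ‖curl (u t) y‖ →
      ‖x - y‖ ≤ R * Real.sqrt (ν / ‖curl (u t) x‖) →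
        Real.sqrt (1 - (inner ℝ (‖curl (u t) x‖⁻¹ • curl (u t) x)
          (‖curl (u t) y‖⁻¹ • curl (u t) y)) ^ 2) ≤ ε :=
  scaledTopSine_le_of_sineCoherent (ω := fun t => curl (u t)) hν one_pos
    (fun _ε' hε' => aprioriContinuousAlignment_of_lt hν hT hcl hLH hdec hT''0 hT'' one_pos hε')
    hlam hR hε

/-- **W3 is equivalent to W3 at first blow-up times.** The door W3 = `AprioriScaledTopAlignment`
(stmt-NavierStokesRegularity-19901) holds if and only if its conclusion holds for every classical
Leray–Hopf solution from a rapidly decaying datum on `[0, T)` that does NOT extend classically past `T`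
(solutions that extend are covered by `scaledTopAlignmentAt_of_hasSmoothExtensionPast`). With the
route's residual hard core NoTypeII such a `T` is a Type-I blow-up time — the regime of GAP″ and of
Giga–Miura's (CA′). An equivalence of OPEN statements; nothing is proved about W3 itself. [folklore] -/
theorem aprioriScaledTopAlignment_iff_singular :
    Summit.NavierStokesRegularity.NavierStokesRegularity.Theses.ScaledTopAlignment.AprioriScaledTopAlignment ↔
    ∀ (ν T : ℝ), 0 < ν → 0 < T → ∀ (u : ℝ → EuclideanSpace ℝ (Fin 3) → EuclideanSpace ℝ (Fin 3))
      (p : ℝ → EuclideanSpace ℝ (Fin 3) → ℝ),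
      IsClassicalNSSolutionOn (Set.Ico 0 T) ν 0 u p → IsLerayHopfOn T ν 0 (u 0) u →
      HasRapidSpatialDecay (u 0) → ¬ HasSmoothExtensionPast ν 0 u T →
      ∀ lam : ℝ, 0 < lam → lam < 1 → ∀ R : ℝ, 0 < R → ∀ ε : ℝ, 0 < ε →
      ∃ M : ℝ, 0 < M ∧ ∀ t ∈ Set.Ico 0 T, ∀ x y : EuclideanSpace ℝ (Fin 3),
        M ≤ ‖curl (u t) x‖ → lam * ‖curl (u t) x‖ ≤ ‖curl (u t) y‖ →
        ‖x - y‖ ≤ R * Real.sqrt (ν / ‖curl (u t) x‖) →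
          Real.sqrt (1 - (inner ℝ (‖curl (u t) x‖⁻¹ • curl (u t) x)
            (‖curl (u t) y‖⁻¹ • curl (u t) y)) ^ 2) ≤ ε := by
  constructor
  · intro hW3 ν T hν hT u p hcl hLH hdec _hext lam hlam hlam1 R hR ε hε
    exact hW3 ν T hν hT u p hcl hLH hdec lam hlam hlam1 R hR ε hε
  · intro hsing ν T hν hT u p hcl hLH hdec lam hlam hlam1 R hR ε hε
    by_cases hext : HasSmoothExtensionPast ν 0 u T
    · exact scaledTopAlignmentAt_of_hasSmoothExtensionPast hν hT hcl hLH hdec hext hlam hR hε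
    · exact hsing ν T hν hT u p hcl hLH hdec hext lam hlam hlam1 R hR ε hε

end Summit.NavierStokesRegularity.NavierStokesRegularity.Theorems

end
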